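import Mathlib
import Summits.NavierStokesRegularity.NavierStokesRegularity.Theses.EulerZoomLiouville
import Summits.NavierStokesRegularity.NavierStokesRegularity.Theorems.EulerZoomLiouvillePowerGaugeEulerLiouvilleLargeRho
import Summits.NavierStokesRegularity.NavierStokesRegularity.Theorems.EulerZoomLiouvillePowerGaugeEulerLiouvillePastIrrotational
import Summits.NavierStokesRegularity.NavierStokesRegularity.Theorems.EulerZoomLiouvillePowerGaugeEulerLiouvilleStretchingBudgetFloorTransport
import Summits.NavierStokesRegularity.NavierStokesRegularity.Theorems.EulerZoomLiouvillePowerGaugeEulerLiouvilleStretchingBudgetStarvation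
import Summits.NavierStokesRegularity.NavierStokesRegularity.Theorems.EulerZoomLiouvillePowerGaugeEulerLiouvilleStretchingBudgetStratum
import Summits.NavierStokesRegularity.NavierStokesRegularity.Theorems.EulerZoomLiouvillePowerGaugeEulerLiouvilleStretchingBudgetFloorTransportFree
import Summits.NavierStokesRegularity.NavierStokesRegularity.Theorems.EulerZoomLiouvillePowerGaugeEulerLiouvilleStretchingBudgetStarvationFree
import Summits.NavierStokesRegularity.NavierStokesRegularity.Theorems.EulerZoomLiouvillePowerGaugeEulerLiouvilleStretchingBudgetStratumFree
import Summits.NavierStokesRegularity.NavierStokesRegularity.Theorems.EulerZoomLiouvillePowerGaugeEulerLiouvilleAnchoredBudgetCutoffFlow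
import Literature.Analysis.FluidPDE.ClassicalSolution
import Literature.Analysis.FluidPDE.VectorCalculus
import HarnessLib.Audit

/-!
**rev5 (ns-idea-11 g5, 2026-08-28): STATUS — the two stratum stubs are now LANDED THEOREMS and are discharged BY NAME below
(K1 `stub_floorTransport` := `StretchingBudget.floorBlobsPersist_of_driftingPast_free`; K2 `stub_budgetStarvation` := `StretchingBudget.pastCurlFree_of_floorBlobsPersist_free`; both gradient-free, landed by ns-sfl-p1 g4); the only `sorry` left in
this file is the declared open residue K3 `stub_budgetRest` (members outside the stratum; crux-sized, not claimed).  The composition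
`PowerGaugeEulerLiouville_of` is unchanged and kernel-checked.  No summit is proved by a line.**
-/

/-!
# Line `stretching-budget` (ideator ns-idea-11 g4, lens «complete» = program-completion) for the crux
# `EulerZoomLiouville.PowerGaugeEulerLiouville` (stmt-NavierStokesRegularity-19832)

PROGRAMME COMPLETED.  The LAGRANGIAN STRETCHING-RATE programme of the Euler blow-up literature — Constantin 1994
(SIAM Rev. 36, the representation `α(x) = ⟪S(x)ξ, ξ⟫` of the vortex-stretching rate and `D_t|ω| = α|ω|`), Chae's refined
Beale–Kato–Majda criteria (blow-up at `T*` iff the POSITIVE stretching budget `∫^{T*} ‖α⁺(t)‖_∞ dt` diverges; the tree's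
[Chae2010, Thm 1.1 proof display], Majda–Bertozzi §1.6 (1.51), §4.2), and the lead's two ANCIENT forms of it
(`KelvinPhysical.ae_eq_zero_of_gauge_of_subunitVortexStretching`, `…smallTypeIGradient`: BOTH need the GLOBAL TYPE-I GRADIENT
bound `‖∇u(τ)‖_∞ ≤ K'/(−τ)` — to run Grönwall AND to have the particle flow) — has one author-named gap on the Liouville side:
the forward criterion is a statement about the time-integral of `α⁺` ALONE, while every ancient-side use so far needs a
two-sided gradient envelope.  This line removes the gradient envelope: the one-sided budget `∫_{−∞}^{T₁} ‖α⁺‖_∞ < ∞`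
(more generally `α ≤ K/(−τ) + Λ(τ)`, `Λ ∈ L¹(−∞,T₁)`, `0 ≤ K < K₀(ρ,κ)`) plus a VELOCITY envelope `‖u(τ)‖_∞ ≤ M(−τ)^{−κ}`
(drift, as in the seat's `casimir-floor` / `swirl-capacity`) already forces triviality — by an INTEGRAL race instead of a
pointwise comparison:

  (i)  FLOOR TRANSPORT (K1 `stub_floorTransport`): backward Grönwall along particle paths, `D_σ|ω(X(σ),σ)|² = 2α|ω|² ≤
       2(K/(−σ) + Λ)|ω|²`, gives `|ω(X(t₁),t₁)|² ≥ |ω(X(t₀),t₀)|² e^{−2∫Λ} ((−t₀)/(−t₁))^{2K}` for `t₁ < t₀`; a late blob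
       `B(x₀,δ)` on which `|ω(t₀)| ≥ w` is carried to a measurable set `T` of the SAME VOLUME (`det DX = 1`) inside
       `B(0, ‖x₀‖ + δ + driftRadius)` (velocity envelope) on which `|ω(t₁)|² ≥ w² e^{−2Λ₁} ((−t₀)/(−t₁))^{2K}`;
  (ii) STARVATION (K2 `stub_budgetStarvation`): the enstrophy floor `vol(B) w² e^{−2Λ₁} (−t₀)^{2K} (−t₁)^{−2K}` sits inside `B(a)`
       during the window `t₁ ∈ (−S_a, t₀)`, `S_a ≍ min(a², (a/M)^{1/(1−κ)})`, so `∫_{−a²}^{0}∫_{B(a)}|curl u|² ≳ S_a^{1−2K}`, while the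
       `E`-gauge of the class gives `≤ 16 c a^{1−ρ}` (`CasimirFloor.lintegral_window_sq_curl_le`); `min(2, 1/(1−κ))(1−2K) > 1−ρ`, i.e.
       `K < K₀(ρ,κ) := min((1+ρ)/4, (κ+ρ−κρ)/2)`, is a contradiction as `a → ∞`.  Hence `curl u ≡ 0` on `(−∞,T₁)`, and the lead's
       LANDED `PastIrrotational.ae_eq_zero_of_gauge_of_pastIrrotational` concludes (used BY NAME in the composition below).

THE STRATUM `IsStretchingBudgeted ρ`: classical members (`IsClassicalEulerSolutionOn (−∞,0)`) with, on some far past `(−∞,T₁)`,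
a velocity envelope `M(−τ)^{−κ}` (`κ < 1`) — rev2: NO gradient clause at all (the cutoff-field route of `stub_floorTransport` owns the flow locally) —
and a stretching budget `(K, Λ)` with `0 ≤ K < K₀(ρ,κ)`, `Λ ≥ 0` integrable.  In words: «ancient members are born by an INFINITE
accumulated positive stretching» — the mirror image of the forward `α⁺`-criterion.  General 3D: no symmetry, no self-similarity,
no Type-I rate, no decay of the gradient.  `K = 0`, `Λ = ‖α⁺‖_∞`: integrable positive stretching; `Λ = 0`: Type-I-rate stretching
below `K₀ ≤ 3/8` (the lead's `K < 1` needs the Type-I GRADIENT; here the velocity envelope replaces it and the price is the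
smaller constant).  Every putative self-similar member has `sup (−τ)α ≥ 1` along vortical paths (CIV 2026 Prop. 3.3) and is
correctly OUTSIDE the stratum.

REV4 — WHAT IS LANDED IN THE TREE (2026-08-28, provers ns-in-ser-c g2; all `--supports stmt-19832 --as helper`, std axioms): the rev1
SUB-STRATUM `IsStretchingBudgetedGrad ρ` (= the stratum PLUS rev1's clause «`∇u` bounded on every compact time interval of `(−∞,0)`, uniformly
in `x`») is PROVED TRIVIAL for `0 < ρ ≤ 1/2`, BY NAME, below: `floorTransportGrad := StretchingBudget.floorBlobsPersist_of_driftingPast` (K1-with-clause,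
p630159), `budgetStarvationGrad := StretchingBudget.pastCurlFree_of_floorBlobsPersist` (K2-with-clause, p629500), `stretchingBudgetedGrad_vanishes :=
StretchingBudget.ae_eq_zero_of_gauge_of_stretchingBudgeted` (the sub-stratum theorem, p630534), and the ONE-HYPOTHESIS composition
`PowerGaugeEulerLiouville_of_budgetRestGrad : Sig.budgetRestGrad → crux` (kernel-checked from landed theorems only).  What stays OPEN in this file:
the GRADIENT-FREE upgrades K1 `stub_floorTransport` (M: the landed K1 proof with the cutoff-field flow `AnchoredBudget.cutoffFlow` —
`det_fderiv_cutoffFlow_eq_one`, `volume_image_cutoffFlow_eq`, `measurableSet_image_cutoffFlow`, p631088 — in place of the global flow) and K2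
`stub_budgetStarvation` (S: the landed K2 proof VERBATIM with its unused binder `_hgrad` deleted), whose only effect is the smaller residue
`stub_budgetRest` (gradient-free) in place of `Sig.budgetRestGrad`; and the residue itself.

RESIDUE `stub_budgetRest` = members outside the stratum (weak, or without velocity envelope, or with divergent positive stretching
budget at `−∞`) — OPEN, crux-sized, NOT claimed; it contains `birth`'s three open stubs minus the stratum.  Nothing here is wired
into the LEAD's skeleton by this seat (files only); the LEAD may cite the landed stratum theorem by name.
Crux 19832, rung N0 and NS regularity stay OPEN.  No summit is proved by a line.
-/

open MeasureTheory Set Filter Topology Metric Real InnerProductSpace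
open scoped ENNReal NNReal RealInnerProductSpace
open Literature.Analysis Literature.Analysis.FluidPDE

set_option linter.dupNamespace false

namespace Summit.NavierStokesRegularity.NavierStokesRegularity.Cruxes.PowerGaugeEulerLiouville.StretchingBudget

/-- Local abbreviation: ℝ³. -/
abbrev E3 : Type := EuclideanSpace ℝ (Fin 3)

/-- Membership in Seregin's power-gauged ancient Euler class — verbatim the three hypotheses of the crux (same as `Birth.InClass`). -/
@[reducible] def InClass (ρ : ℝ) (u : ℝ → E3 → E3) (p : ℝ → E3 → ℝ) (H : ℝ → E3 → E3 →L[ℝ] E3)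
    (c : ℝ≥0) : Prop :=
  IsSuitableWeakSolutionOn (slab (EuclideanSpace ℝ (Fin 3)) (Set.Iio 0) isOpen_Iio) 0 0 u p ∧
    HasWeakSpatialGradientOn (slab (EuclideanSpace ℝ (Fin 3)) (Set.Iio 0) isOpen_Iio) u H ∧
    (∀ a : ℝ, 0 < a →
      ENNReal.ofReal (a ^ (2 * ρ)) * cknA a (0 : ℝ × E3) u + ENNReal.ofReal (a ^ ρ) * cknE a (0 : ℝ × E3) H +
        ENNReal.ofReal (a ^ (2 * ρ)) * cknD a (0 : ℝ × E3) p ≤ (c : ℝ≥0∞))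

/-- The conclusion of the crux: `u` vanishes a.e. on the past slab. -/
@[reducible] def VanishesAE (u : ℝ → E3 → E3) : Prop :=
  Function.uncurry u =ᵐ[volume.restrict (Set.Iio (0 : ℝ) ×ˢ (Set.univ : Set E3))] 0

/-- Backward drift radius of the velocity envelope `‖u(s,·)‖_∞ ≤ M (−s)^{−κ}` between times `t₁ < t₀ < 0` (`κ < 1`):
`M ((−t₁)^{1−κ} − (−t₀)^{1−κ}) / (1−κ)` (the bound of the tree's `SwirlfreeLedger.norm_evolutionMap_sub_le`; same formula as the
seat's `CasimirFloor.driftRadius`, restated — lines do not share declarations). -/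
noncomputable def driftRadius (M κ t₀ t₁ : ℝ) : ℝ :=
  M / (1 - κ) * ((-t₁) ^ (1 - κ) - (-t₀) ^ (1 - κ))

/-- A classical member with an explicit DRIFTING FAR PAST `(T₁, M, κ)`: classical Euler on `(−∞,0) × ℝ³`; `T₁ ≤ 0`, `0 ≤ M`, `κ < 1`;
velocity envelope `‖u(τ,x)‖ ≤ M(−τ)^{−κ}` for `τ < T₁` — and (rev2) NOTHING on the gradient: rev0–rev1 carried «gradient bounded on compact
time sets, uniformly in `x`» only to make the particle flow global; it is not needed — labels in a blob `B ⊆ B(0,R)` travel at most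
`driftRadius`, so the Literature flow kit is run on the Lipschitz CUTOFF `ψ·u` (`ψ = 1` on `B(0, R + driftRadius + 1)`), whose trajectories
from `B` never leave the zone `ψ = 1` (speed `≤ |u| ≤ M(−σ)^{−κ}`), are `u`-trajectories there, and have Jacobian one by Liouville's formula
`Literature.Analysis.FluidPDE.det_fderiv_evolutionMap_eq_exp_integral_divergence_of_mem` (`div(ψu) = 0` where `ψ = 1`).  NESTING (critic V33a P-rev2): the
first two conjuncts are LITERALLY the sibling «anchored-budget»'s `IsAnchorablePast u p T₁` (classical ∧ `T₁ ≤ 0`), so anchorable ⊇ drifting(M,κ) ⊇ budgeted and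
one cutoff-flow lemma serves K1, T1 (helicity-tube) and C1 (anchored-budget) alike. -/
def IsDriftingPastWith (u : ℝ → E3 → E3) (p : ℝ → E3 → ℝ) (T₁ M κ : ℝ) : Prop :=
  IsClassicalEulerSolutionOn (Set.Iio 0) 0 u p ∧ T₁ ≤ 0 ∧ 0 ≤ M ∧ κ < 1 ∧
    (∀ τ : ℝ, τ < T₁ → ∀ x : E3, ‖u τ x‖ ≤ M * (-τ) ^ (-κ))

/-- A STRETCHING BUDGET `(K, Λ)` on the far past `(−∞,T₁)`: `Λ ≥ 0` integrable on `(−∞,T₁)` and the vortex-stretching form obeys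
`⟪∇u(τ,x) ω, ω⟫ ≤ (K/(−τ) + Λ(τ)) |ω|²`, `ω = curl u(τ,x)` — i.e. Constantin's rate `α = ⟪Sξ,ξ⟫ ≤ K/(−τ) + Λ(τ)` wherever `ω ≠ 0`
(the antisymmetric part of `∇u` drops out of the quadratic form).  `K = 0`: integrable positive stretching `∫_{−∞}^{T₁}‖α⁺‖_∞ < ∞`. -/
def HasStretchingBudget (u : ℝ → E3 → E3) (T₁ K : ℝ) (Λ : ℝ → ℝ) : Prop :=
  IntegrableOn Λ (Set.Iio T₁) ∧ (∀ τ : ℝ, 0 ≤ Λ τ) ∧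
    ∀ τ : ℝ, τ < T₁ → ∀ x : E3,
      ⟪fderiv ℝ (u τ) x (curl (u τ) x), curl (u τ) x⟫ ≤ (K / (-τ) + Λ τ) * ‖curl (u τ) x‖ ^ 2

/-- The threshold of the exponent race (derived, not chosen): `K₀(ρ,κ) = min((1+ρ)/4, (κ+ρ−κρ)/2)`.  For `κ ≥ 1/2` the binding
constraint is the parabolic window (`a²` vs `a^{1−ρ}`: `2(1−2K) > 1−ρ`), for `κ < 1/2` the drift window
(`a^{(1−2K)/(1−κ)}` vs `a^{1−ρ}`). `K₀ > 0` iff `κ > −ρ/(1−ρ)`. -/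
noncomputable def stretchingThreshold (ρ κ : ℝ) : ℝ :=
  min ((1 + ρ) / 4) ((κ + ρ - κ * ρ) / 2)

/-- THE STRATUM: a drifting classical far past carrying a stretching budget below the threshold. -/
def IsStretchingBudgeted (ρ : ℝ) (u : ℝ → E3 → E3) (p : ℝ → E3 → ℝ) : Prop :=
  ∃ T₁ M κ K : ℝ, ∃ Λ : ℝ → ℝ,
    IsDriftingPastWith u p T₁ M κ ∧ 0 ≤ K ∧ K < stretchingThreshold ρ κ ∧ HasStretchingBudget u T₁ K Λ

/-- FLOOR BLOBS PERSIST BACKWARD (the conclusion shape of K1): every late blob `B(x₀,δ)` at a time `t₀ < T₁` on which `|curl u(t₀)| ≥ w ≥ 0`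
has, at every earlier time `t₁ < t₀`, a measurable avatar `T ⊆ B(0, ‖x₀‖ + δ + driftRadius M κ t₀ t₁)` of the SAME volume on which
`|curl u(t₁)|² ≥ w² · e^{−2∫_{(t₁,t₀)}Λ} · ((−t₀)/(−t₁))^{2K}` (in truth `T` = backward flow image of the blob). -/
def FloorBlobsPersist (u : ℝ → E3 → E3) (T₁ M κ K : ℝ) (Λ : ℝ → ℝ) : Prop :=
  ∀ t₀ : ℝ, t₀ < T₁ → ∀ (x₀ : E3) (δ w : ℝ), 0 < δ → 0 ≤ w →
    (∀ x ∈ ball x₀ δ, w ≤ ‖curl (u t₀) x‖) →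
    ∀ t₁ : ℝ, t₁ < t₀ →
      ∃ T : Set E3, MeasurableSet T ∧ T ⊆ ball (0 : E3) (‖x₀‖ + δ + driftRadius M κ t₀ t₁) ∧
        volume T = volume (ball x₀ δ) ∧
        ∀ x ∈ T,
          w ^ 2 * Real.exp (-(2 * ∫ s in Set.Ioo t₁ t₀, Λ s)) * ((-t₀) / (-t₁)) ^ (2 * K) ≤ ‖curl (u t₁) x‖ ^ 2

/-! ## Registered stub signatures -/

/-- Signature of `stub_floorTransport` (K1, size M): on a drifting classical far past with a stretching budget `(K, Λ)`, `K ≥ 0`, floor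
blobs persist.  Proof (rev2, no gradient clause): run the Literature flow kit on the CUTOFF `ũ = ψ·u`, `ψ` a smooth bump `= 1` on
`B(0,R')`, `R' = R + driftRadius M κ t₀ t₁ + 1`, `B ⊆ B(0,R)`: `ũ` is jointly smooth and `ODE.IsUniformlyLipschitzOn ũ (Icc t₁ t₀)` (smooth, compact
support in `x`), `X := ODE.evolutionMap ũ t₀ ·` a global flow of diffeomorphisms (`IsUniformlyLipschitzOn.contDiff_evolutionMap`,
`bijective_evolutionMap`); CONFINEMENT `‖X(t,a) − a‖ ≤ driftRadius` for `a ∈ B` from `|ũ| ≤ |u| ≤ M(−σ)^{−κ}` (pattern of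
`SwirlfreeLedger.norm_evolutionMap_sub_le` / `FadingPast.norm_evolutionMap_sub_le`), so these trajectories stay where `ψ = 1`, i.e. they ARE
`u`-trajectories; VOLUME `vol(X_{t₁} B) = vol B` by Liouville's formula `Literature.Analysis.FluidPDE.det_fderiv_evolutionMap_eq_exp_integral_divergence_of_mem`
(`det DX = exp ∫ div ũ(X) = 1`, `div ũ = ψ div u + ∇ψ·u = 0` on `B(0,R')`) and `MeasureTheory.lintegral_abs_det_fderiv_eq_addHaar_image`; FLOOR: along
each path `m(σ) = |curl u(σ, X(σ,a))|²` has `m' = 2⟪∇u ω, ω⟫ ≤ 2(K/(−σ)+Λ(σ)) m` (vorticity equation along trajectories, as inside the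
lead's `KelvinPhysical.norm_curl_sq_le_of_subunitVortexStretching`), Grönwall on `[t₁,t₀]`; MEASURABILITY: continuous injective image
of a ball. [cite: MajdaBertozziCUP2002, §1.6 (1.51), §1.3 Prop. 1.4, §2.5 (2.115)–(2.117); Chae2010, Thm 1.1 (proof display)] -/
def Sig.stub_floorTransport : Prop :=
  ∀ (u : ℝ → E3 → E3) (p : ℝ → E3 → ℝ) (T₁ M κ K : ℝ) (Λ : ℝ → ℝ),
    IsDriftingPastWith u p T₁ M κ → 0 ≤ K → HasStretchingBudget u T₁ K Λ → FloorBlobsPersist u T₁ M κ K Λ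

/-- Signature of `stub_budgetStarvation` (K2, size M): GIVEN persistent floor blobs, a member of the class (`0 < ρ ≤ 1/2`) on the stratum
has an IRROTATIONAL far past `(−∞,T₁)`.  Proof: if `curl u(t₀) x₀ ≠ 0` for some `t₀ < T₁` (wlog `t₀ ≤ −1`; moving `t₀` earlier only
shrinks nothing: the hypothesis holds on the whole past), continuity gives a blob `B(x₀,δ)` with `|curl u(t₀)| ≥ w := |curl u(t₀)x₀|/2 > 0`;
`Λ₁ := ∫_{−∞}^{T₁} Λ < ∞`; for `a` large and every `t₁ ∈ (−S_a, t₀)`, `S_a := min(a², ((1−κ)(a/2)/(M+1))^{1/(1−κ)})` (so that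
`‖x₀‖ + δ + driftRadius ≤ a`), K1's avatar lies in `B(0,a)` and carries enstrophy `≥ vol(B(x₀,δ)) w² e^{−2Λ₁} (−t₀)^{2K} (−t₁)^{−2K}`;
integrate in `t₁`: `∫_{−a²}^{0}∫_{B(a)}|curl u|² ≥ C (S_a^{1−2K} − (−t₀)^{1−2K})` (`2K < 1` since `K < K₀ ≤ 3/8`), against
`≤ 16 c a^{1−ρ}` (`CasimirFloor.lintegral_window_sq_curl_le`, from the `E`-gauge); the exponent race `min(2,1/(1−κ))(1−2K) > 1−ρ ⇔
K < stretchingThreshold ρ κ` (`threshold_iff` below) is a contradiction as `a → ∞`. [cite: MajdaBertozziCUP2002, §1.6 (1.51);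
CaffarelliKohnNirenberg1982, §2] -/
def Sig.stub_budgetStarvation : Prop :=
  ∀ ρ : ℝ, 0 < ρ → ρ ≤ 1 / 2 → ∀ (u : ℝ → E3 → E3) (p : ℝ → E3 → ℝ) (H : ℝ → E3 → E3 →L[ℝ] E3) (c : ℝ≥0),
    InClass ρ u p H c → ∀ (T₁ M κ K : ℝ) (Λ : ℝ → ℝ), IsDriftingPastWith u p T₁ M κ → 0 ≤ K →
      K < stretchingThreshold ρ κ → HasStretchingBudget u T₁ K Λ → FloorBlobsPersist u T₁ M κ K Λ →
        ∀ τ : ℝ, τ < T₁ → ∀ x : E3, curl (u τ) x = 0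

/-- Signature of `stub_budgetRest` (K3, OPEN, crux-sized — NOT claimed by this line): in the window `0 < ρ ≤ 1/2`, members OUTSIDE the
stratum (weak; or classical without a velocity envelope / locally bounded gradient; or whose positive stretching budget at `−∞` diverges
faster than `K₀/(−τ)`) are trivial.  This is where `birth`'s open stubs live, minus the stratum. -/
def Sig.stub_budgetRest : Prop :=
  ∀ ρ : ℝ, 0 < ρ → ρ ≤ 1 / 2 → ∀ (u : ℝ → E3 → E3) (p : ℝ → E3 → ℝ) (H : ℝ → E3 → E3 →L[ℝ] E3) (c : ℝ≥0),
    InClass ρ u p H c → ¬ IsStretchingBudgeted ρ u p → VanishesAE u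

/-! ## Stubs -/

/-- STUB K1 [LANDED (rev5 wiring, ns-sfl-p1 g4): `StretchingBudget.floorBlobsPersist_of_driftingPast_free`
(`Theorems/EulerZoomLiouvillePowerGaugeEulerLiouvilleStretchingBudgetFloorTransportFree.lean`) — the GRADIENT-FREE upgrade of
`floorTransportGrad` (p630159) via the cutoff-field flow `AnchoredBudget.cutoffFlow` (p631088); discharged here BY NAME, no sorry]. -/
theorem stub_floorTransport : Sig.stub_floorTransport := by
  intro u p T₁ M κ K Λ hdp hK hB
  exact Summit.NavierStokesRegularity.NavierStokesRegularity.Theorems.PowerGaugeEulerLiouville.StretchingBudget.floorBlobsPersist_of_driftingPast_free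
    u p T₁ M κ K Λ hdp hK hB

/-- STUB K2 [LANDED (rev5 wiring, ns-sfl-p1 g4): `StretchingBudget.pastCurlFree_of_floorBlobsPersist_free`
(`Theorems/EulerZoomLiouvillePowerGaugeEulerLiouvilleStretchingBudgetStarvationFree.lean`) — the GRADIENT-FREE upgrade of `budgetStarvationGrad`
(p629500); discharged here BY NAME, no sorry]. -/
theorem stub_budgetStarvation : Sig.stub_budgetStarvation := by
  intro ρ hρ hρ2 u p H c hcl T₁ M κ K Λ hdp hK hKt hB hF
  exact Summit.NavierStokesRegularity.NavierStokesRegularity.Theorems.PowerGaugeEulerLiouville.StretchingBudget.pastCurlFree_of_floorBlobsPersist_free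
    ρ hρ hρ2 u p H c hcl T₁ M κ K Λ hdp hK hKt hB hF

/-- STUB K3 [OPEN residue, not claimed; implied by the larger rev1 residue `Sig.budgetRestGrad` (`budgetRest_of_budgetRestGrad`)]. -/
theorem stub_budgetRest : Sig.stub_budgetRest := by
  sorry

/-! ## LANDED (rev4): the rev1 sub-stratum with the locally-bounded-gradient clause is PROVED in the tree — discharged here BY NAME -/

/-- rev1's drifting past: `IsDriftingPastWith` PLUS «`∇u` bounded on every compact time interval of `(−∞,0)`, uniformly in `x`» — verbatim the
hypothesis of the landed `StretchingBudget.floorBlobsPersist_of_driftingPast` (the clause makes the TRUE particle flow global). -/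
def IsDriftingPastWithGrad (u : ℝ → E3 → E3) (p : ℝ → E3 → ℝ) (T₁ M κ : ℝ) : Prop :=
  IsClassicalEulerSolutionOn (Set.Iio 0) 0 u p ∧ T₁ ≤ 0 ∧ 0 ≤ M ∧ κ < 1 ∧
    (∀ τ : ℝ, τ < T₁ → ∀ x : E3, ‖u τ x‖ ≤ M * (-τ) ^ (-κ)) ∧
    (∀ t₁ t₂ : ℝ, t₁ < t₂ → t₂ < 0 → ∃ L : ℝ, ∀ τ ∈ Set.Icc t₁ t₂, ∀ x : E3, ‖fderiv ℝ (u τ) x‖ ≤ L)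

/-- The sub-stratum nests in the stratum (drop the clause). -/
theorem IsDriftingPastWithGrad.driftingPastWith {u : ℝ → E3 → E3} {p : ℝ → E3 → ℝ} {T₁ M κ : ℝ}
    (h : IsDriftingPastWithGrad u p T₁ M κ) : IsDriftingPastWith u p T₁ M κ :=
  ⟨h.1, h.2.1, h.2.2.1, h.2.2.2.1, h.2.2.2.2.1⟩

/-- rev1's stratum (= `IsStretchingBudgeted` with the gradient clause). -/
def IsStretchingBudgetedGrad (ρ : ℝ) (u : ℝ → E3 → E3) (p : ℝ → E3 → ℝ) : Prop :=
  ∃ T₁ M κ K : ℝ, ∃ Λ : ℝ → ℝ,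
    IsDriftingPastWithGrad u p T₁ M κ ∧ 0 ≤ K ∧ K < stretchingThreshold ρ κ ∧ HasStretchingBudget u T₁ K Λ

theorem IsStretchingBudgetedGrad.stretchingBudgeted {ρ : ℝ} {u : ℝ → E3 → E3} {p : ℝ → E3 → ℝ}
    (h : IsStretchingBudgetedGrad ρ u p) : IsStretchingBudgeted ρ u p := by
  obtain ⟨T₁, M, κ, K, Λ, hD, hK0, hK, hB⟩ := h
  exact ⟨T₁, M, κ, K, Λ, hD.driftingPastWith, hK0, hK, hB⟩

/-- K1 with the clause (rev1 text of `Sig.stub_floorTransport`). -/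
def Sig.floorTransportGrad : Prop :=
  ∀ (u : ℝ → E3 → E3) (p : ℝ → E3 → ℝ) (T₁ M κ K : ℝ) (Λ : ℝ → ℝ),
    IsDriftingPastWithGrad u p T₁ M κ → 0 ≤ K → HasStretchingBudget u T₁ K Λ → FloorBlobsPersist u T₁ M κ K Λ

/-- **LANDED K1-with-clause, BY NAME** (p630159, `Theorems/EulerZoomLiouvillePowerGaugeEulerLiouvilleStretchingBudgetFloorTransport.lean`). -/
theorem floorTransportGrad : Sig.floorTransportGrad :=
  Summit.NavierStokesRegularity.NavierStokesRegularity.Theorems.PowerGaugeEulerLiouville.StretchingBudget.floorBlobsPersist_of_driftingPast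

/-- K2 with the clause (rev1 text of `Sig.stub_budgetStarvation`). -/
def Sig.budgetStarvationGrad : Prop :=
  ∀ ρ : ℝ, 0 < ρ → ρ ≤ 1 / 2 → ∀ (u : ℝ → E3 → E3) (p : ℝ → E3 → ℝ) (H : ℝ → E3 → E3 →L[ℝ] E3) (c : ℝ≥0),
    InClass ρ u p H c → ∀ (T₁ M κ K : ℝ) (Λ : ℝ → ℝ), IsDriftingPastWithGrad u p T₁ M κ → 0 ≤ K →
      K < stretchingThreshold ρ κ → HasStretchingBudget u T₁ K Λ → FloorBlobsPersist u T₁ M κ K Λ →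
        ∀ τ : ℝ, τ < T₁ → ∀ x : E3, curl (u τ) x = 0

/-- **LANDED K2-with-clause, BY NAME** (p629500, `Theorems/EulerZoomLiouvillePowerGaugeEulerLiouvilleStretchingBudgetStarvation.lean`). -/
theorem budgetStarvationGrad : Sig.budgetStarvationGrad :=
  Summit.NavierStokesRegularity.NavierStokesRegularity.Theorems.PowerGaugeEulerLiouville.StretchingBudget.pastCurlFree_of_floorBlobsPersist

/-- **LANDED SUB-STRATUM THEOREM, BY NAME** (p630534, `…StretchingBudgetStratum.lean`): for `0 < ρ ≤ 1/2`, a member of the class on the rev1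
sub-stratum vanishes a.e. -/
theorem stretchingBudgetedGrad_vanishes :
    ∀ ρ : ℝ, 0 < ρ → ρ ≤ 1 / 2 → ∀ (u : ℝ → E3 → E3) (p : ℝ → E3 → ℝ) (H : ℝ → E3 → E3 →L[ℝ] E3) (c : ℝ≥0),
      InClass ρ u p H c → IsStretchingBudgetedGrad ρ u p → VanishesAE u :=
  fun _ρ hρ hρ2 _u _p _H _c hin hS =>
    Summit.NavierStokesRegularity.NavierStokesRegularity.Theorems.PowerGaugeEulerLiouville.StretchingBudget.ae_eq_zero_of_gauge_of_stretchingBudgeted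
      hρ hρ2 hin.1 hin.2.1 hin.2.2 hS

/-- The rev1 residue (LARGER than `Sig.stub_budgetRest`: members outside the SUB-stratum). Not a stub: a hypothesis of the by-name composition. -/
def Sig.budgetRestGrad : Prop :=
  ∀ ρ : ℝ, 0 < ρ → ρ ≤ 1 / 2 → ∀ (u : ℝ → E3 → E3) (p : ℝ → E3 → ℝ) (H : ℝ → E3 → E3 →L[ℝ] E3) (c : ℝ≥0),
    InClass ρ u p H c → ¬ IsStretchingBudgetedGrad ρ u p → VanishesAE u

/-- The gradient-free residue is implied by the rev1 residue (the sub-stratum nests in the stratum). -/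
theorem budgetRest_of_budgetRestGrad (h : Sig.budgetRestGrad) : Sig.stub_budgetRest :=
  fun ρ hρ hρ2 u p H c hin hS => h ρ hρ hρ2 u p H c hin (fun hG => hS hG.stretchingBudgeted)

/-- The cutoff-field kit the gradient-free K1 runs on is in the tree (p631088): Jacobian one of the cutoff flow on STAY labels. -/
example := @Summit.NavierStokesRegularity.NavierStokesRegularity.Theorems.PowerGaugeEulerLiouville.AnchoredBudget.det_fderiv_cutoffFlow_eq_one

/-! ## Sanity checks on the stratum arithmetic (kernel-checked) -/

/-- The threshold never exceeds `3/8` in the window `ρ ≤ 1/2` (the lead's Type-I-gradient filler reaches `K < 1`; the trade here is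
«no gradient rate, smaller constant»). -/
theorem threshold_le {ρ κ : ℝ} (hρ : ρ ≤ 1 / 2) : stretchingThreshold ρ κ ≤ 3 / 8 := by
  unfold stretchingThreshold
  exact (min_le_left _ _).trans (by linarith)

/-- At the energy endpoint `ρ = 1/2` with bounded velocity (`κ = 0`) the threshold is `1/4`. -/
example : stretchingThreshold (1 / 2) 0 = 1 / 4 := by
  unfold stretchingThreshold; norm_num

/-- With sub-parabolic drift (`κ ≥ 1/2`) the threshold is `(1+ρ)/4`. -/
theorem threshold_of_half_le {ρ κ : ℝ} (hρ1 : ρ ≤ 1) (hκ : 1 / 2 ≤ κ) :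
    stretchingThreshold ρ κ = (1 + ρ) / 4 := by
  unfold stretchingThreshold
  apply min_eq_left
  nlinarith

/-- The threshold is positive exactly when `κ > −ρ/(1−ρ)` (for `0 < ρ < 1`): some GROWING velocity envelopes are allowed. -/
theorem threshold_pos_iff {ρ κ : ℝ} (hρ : 0 < ρ) (hρ1 : ρ < 1) :
    0 < stretchingThreshold ρ κ ↔ -ρ / (1 - ρ) < κ := by
  unfold stretchingThreshold
  rw [lt_min_iff, div_lt_iff₀ (by linarith : (0:ℝ) < 1 - ρ)]
  constructor
  · rintro ⟨-, h⟩; nlinarith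
  · intro h; constructor <;> nlinarith

/-- The exponent race behind K2 (drift-window branch): for `κ < 1`, `(1−2K)/(1−κ) > 1−ρ ↔ K < (κ+ρ−κρ)/2`. -/
theorem exponent_race {ρ κ K : ℝ} (hκ : κ < 1) :
    1 - ρ < (1 - 2 * K) / (1 - κ) ↔ K < (κ + ρ - κ * ρ) / 2 := by
  have h1 : 0 < 1 - κ := by linarith
  rw [lt_div_iff₀ h1]
  constructor <;> intro h <;> nlinarith

/-- The exponent race behind K2 (parabolic-window branch): `2(1−2K) > 1−ρ ↔ K < (1+ρ)/4`. -/
theorem exponent_race' {ρ K : ℝ} : 1 - ρ < 2 * (1 - 2 * K) ↔ K < (1 + ρ) / 4 := by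
  constructor <;> intro h <;> linarith

/-! ## Composition -/

/-- **Composition (kernel-checked, no sorry of its own): the three stubs give the crux BY NAME.**  The irrotational far past produced by
K1+K2 is closed by the lead's LANDED filler `PastIrrotational.ae_eq_zero_of_gauge_of_pastIrrotational` (slices `C²` and divergence-free from
the classical structure); `ρ > 1/2` is the landed `powerGaugeEulerLiouville_largeRho`. -/
theorem PowerGaugeEulerLiouville_of :
    Sig.stub_floorTransport → Sig.stub_budgetStarvation → Sig.stub_budgetRest →
      Summit.NavierStokesRegularity.NavierStokesRegularity.Theses.EulerZoomLiouville.PowerGaugeEulerLiouville := by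
  intro h1 h2 h3 ρ hρ u p H c hsw hH hc
  by_cases hhalf : 1 / 2 < ρ
  · exact
      Summit.NavierStokesRegularity.NavierStokesRegularity.Theorems.PowerGaugeEulerLiouville.powerGaugeEulerLiouville_largeRho
        ρ hhalf u p H c hsw hH hc
  · have hρ2 : ρ ≤ 1 / 2 := not_lt.mp hhalf
    by_cases hS : IsStretchingBudgeted ρ u p
    · obtain ⟨T₁, M, κ, K, Λ, hD, hK0, hK, hB⟩ := hS
      have hcurl : ∀ τ : ℝ, τ < T₁ → ∀ x : E3, curl (u τ) x = 0 :=
        h2 ρ hρ hρ2 u p H c ⟨hsw, hH, hc⟩ T₁ M κ K Λ hD hK0 hK hB (h1 u p T₁ M κ K Λ hD hK0 hB)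
      have hcl : IsClassicalEulerSolutionOn (Set.Iio 0) 0 u p := hD.1
      have hT₁ : T₁ ≤ 0 := hD.2.1
      have hmem : ∀ τ : ℝ, τ < T₁ → τ ∈ Set.Iio (0 : ℝ) := fun τ hτ => lt_of_lt_of_le hτ hT₁
      exact
        Summit.NavierStokesRegularity.NavierStokesRegularity.Theorems.PowerGaugeEulerLiouville.PastIrrotational.ae_eq_zero_of_gauge_of_pastIrrotational
          hρ hρ2 hsw hH hc hT₁ (fun τ hτ => (hcl.contDiff_velocity (hmem τ hτ)).of_le (by norm_cast))
          (fun τ hτ => hcl.divFree τ (hmem τ hτ)) hcurl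
    · exact h3 ρ hρ hρ2 u p H c ⟨hsw, hH, hc⟩ hS

/-- **BY-NAME COMPOSITION FROM LANDED THEOREMS ONLY (rev4, kernel-checked, no sorry anywhere in its cone):** modulo the rev1 residue
`Sig.budgetRestGrad`, the crux follows from `powerGaugeEulerLiouville_largeRho` (ρ > 1/2) and the landed sub-stratum theorem
`StretchingBudget.ae_eq_zero_of_gauge_of_stretchingBudgeted` (0 < ρ ≤ 1/2).  The three-stub composition above says the same with the SMALLER
gradient-free residue once K1/K2 (gradient-free) are re-landed. -/
theorem PowerGaugeEulerLiouville_of_budgetRestGrad :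
    Sig.budgetRestGrad →
      Summit.NavierStokesRegularity.NavierStokesRegularity.Theses.EulerZoomLiouville.PowerGaugeEulerLiouville := by
  intro h3 ρ hρ u p H c hsw hH hc
  by_cases hhalf : 1 / 2 < ρ
  · exact
      Summit.NavierStokesRegularity.NavierStokesRegularity.Theorems.PowerGaugeEulerLiouville.powerGaugeEulerLiouville_largeRho
        ρ hhalf u p H c hsw hH hc
  · have hρ2 : ρ ≤ 1 / 2 := not_lt.mp hhalf
    by_cases hS : IsStretchingBudgetedGrad ρ u p
    · exact stretchingBudgetedGrad_vanishes ρ hρ hρ2 u p H c ⟨hsw, hH, hc⟩ hS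
    · exact h3 ρ hρ hρ2 u p H c ⟨hsw, hH, hc⟩ hS

end Summit.NavierStokesRegularity.NavierStokesRegularity.Cruxes.PowerGaugeEulerLiouville.StretchingBudget
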